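import Mathlib.Geometry.Manifold.SmoothEmbedding
import Mathlib.Geometry.Manifold.Instances.Real
import Literature.Topology.FourManifolds.BallGluingCharts
import HarnessLib

/-!
# Half-space parametrisation of a smoothly embedded manifold with boundary near a point

Topic `Literature/Topology/FourManifolds` (consumer-side work for the fact seat
`provefact-Literature.Topology.FourManifolds.Trisection.isConnectedSum_circleProd_of_reducing_nonseparating`:
the local side indicators of a compressing disc, `TwoSidedFromLocalSides.lean`, are read in
charts; this file turns Mathlib's chart-level definition of an immersion into the concrete
parametrisation those charts need).  **Everything here is proved; no new facts.**

`Literature.Topology.FourManifolds.exists_halfSpaceParam_of_isSmoothEmbedding`: let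
`f : M → X` be a `C^∞` embedding (`Manifold.IsSmoothEmbedding (𝓡∂ m) (𝓡 k) ∞ f`) of a manifold
with boundary `M` (modelled on the half-space `EuclideanHalfSpace m`) into a manifold `X`
modelled on `ℝᵏ`, `x₀ ∈ M`, and `Ξ` a chart of the maximal atlas of `X` at `f x₀`.  Mathlib's
`Manifold.IsImmersionAt` *is* the statement that in suitable charts `φ` (of `M`, maximal atlas)
and `ψ` (of `X`) one has `ψ ∘ f ∘ φ⁻¹ = L ∘ (·, 0)` for a linear isomorphism
`L : ℝᵐ × C ≃L ℝᵏ`.  Consequently `G := ψ⁻¹ ∘ L ∘ (·, 0)` is defined and smooth on an OPEN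
subset `Ω ∋ u₀ = φ x₀` of `ℝᵐ` — also across the boundary hyperplane `{u 0 = 0}` when `x₀` is a
boundary point — and on the half `Ω ∩ {0 ≤ u 0}` it parametrises `range f` near `f x₀`
injectively, boundary points corresponding exactly to `{u 0 = 0}` (invariance of the boundary
for the maximal atlas, `isBoundaryPoint_iff_of_mem_maximalAtlas`, Lee 2013, Thm. 1.46); read in
`Ξ`, the map `E := Ξ ∘ G` is `C^∞` on `Ω` with injective differential at `u₀` (the transition
`Ξ ∘ ψ⁻¹` has invertible derivative, Mathlib
`ModelWithCorners.isInvertible_fderivWithin_extendCoordChange`).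

## References

* J. M. Lee, *Introduction to Smooth Manifolds*, 2nd ed., Springer GTM 218 (2013), Thm. 1.46,
  Thm. 4.12 and Prop. 5.49 (local slice form of immersions / embedded submanifolds).
  [LeeSmoothManifolds2013]
-/

noncomputable section

open Set Function Filter Manifold
open scoped Manifold ContDiff Topology

namespace Literature.Topology.FourManifolds

/-- **Half-space parametrisation of a smooth embedding near a point, read in a given chart.**
Let `f : M → X` be a `C^∞` embedding of a manifold with boundary `M` (model `EuclideanHalfSpace m`)
into a manifold `X` modelled on `ℝᵏ`, `x₀ ∈ M`, and `Ξ` a chart of the maximal atlas of `X` with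
`f x₀ ∈ Ξ.source`.  Then there are `E : ℝᵐ → ℝᵏ`, `G : ℝᵐ → X`, `u₀ ∈ ℝᵐ`, an open `Ω ∋ u₀` and an
open `V ∋ f x₀` such that: `E` is `C^∞` on `Ω` with injective differential at `u₀`;
`0 ≤ u₀ 0`, and `u₀ 0 = 0` iff `x₀` is a boundary point; `G u₀ = f x₀`; on `Ω`, `G` is
continuous, takes values in `Ξ.source` and `E = Ξ ∘ G`; for every open `Ω' ∋ u₀` inside `Ω`
there is an open `V ∋ f x₀`, `V ⊆ Ξ.source`, with `range f ∩ V = G '' (Ω' ∩ {0 ≤ u 0})` (`f` is an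
embedding); `G` is injective on `Ω ∩ {0 ≤ u 0}`; and every `G u` (`u ∈ Ω`, `0 ≤ u 0`) is `f x` for
a point `x` which is a boundary point iff `u 0 = 0`.
(The chart-level definition of an immersion, `Manifold.IsImmersionAt.writtenInCharts`, plus the
invariance of the boundary for charts of the maximal atlas, Lee 2013, Thm. 1.46.)
[cite: LeeSmoothManifolds2013, Thm. 1.46 and Thm. 4.12] -/
theorem exists_halfSpaceParam_of_isSmoothEmbedding
    {k : ℕ} {X : Type*} [TopologicalSpace X] [ChartedSpace (EuclideanSpace ℝ (Fin k)) X]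
    [IsManifold (𝓡 k) ∞ X]
    {m : ℕ} [NeZero m] {M : Type*} [TopologicalSpace M] [ChartedSpace (EuclideanHalfSpace m) M]
    [IsManifold (𝓡∂ m) ∞ M]
    {f : M → X} (hf : IsSmoothEmbedding (𝓡∂ m) (𝓡 k) ∞ f) (x₀ : M)
    {Ξ : OpenPartialHomeomorph X (EuclideanSpace ℝ (Fin k))}
    (hΞ : Ξ ∈ IsManifold.maximalAtlas (𝓡 k) ∞ X)
    (hx₀ : f x₀ ∈ Ξ.source) :
    ∃ (E : EuclideanSpace ℝ (Fin m) → EuclideanSpace ℝ (Fin k)) (G : EuclideanSpace ℝ (Fin m) → X)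
      (u₀ : EuclideanSpace ℝ (Fin m)) (Ω : Set (EuclideanSpace ℝ (Fin m))),
      IsOpen Ω ∧ u₀ ∈ Ω ∧ ContDiffOn ℝ ∞ E Ω ∧ Injective (fderiv ℝ E u₀) ∧
      0 ≤ u₀ 0 ∧ ((𝓡∂ m).IsBoundaryPoint x₀ ↔ u₀ 0 = 0) ∧ G u₀ = f x₀ ∧
      ContinuousOn G Ω ∧ (∀ u ∈ Ω, G u ∈ Ξ.source ∧ E u = Ξ (G u)) ∧
      (∀ Ω' ⊆ Ω, IsOpen Ω' → u₀ ∈ Ω' → ∃ V : Set X, IsOpen V ∧ f x₀ ∈ V ∧ V ⊆ Ξ.source ∧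
        range f ∩ V = G '' {u ∈ Ω' | 0 ≤ u 0}) ∧
      InjOn G {u ∈ Ω | 0 ≤ u 0} ∧
      (∀ u ∈ Ω, 0 ≤ u 0 → ∃ x, G u = f x ∧ ((𝓡∂ m).IsBoundaryPoint x ↔ u 0 = 0)) := by
  -- Mathlib's immersion data at `x₀`
  have h : IsImmersionAt (𝓡∂ m) (𝓡 k) ∞ f x₀ := hf.isImmersion.isImmersionAt x₀
  set φ := h.domChart with hφ_def
  set ψ := h.codChart with hψ_def
  set L := h.equiv with hL_def
  have hφ : φ ∈ IsManifold.maximalAtlas (𝓡∂ m) ∞ M := h.domChart_mem_maximalAtlas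
  have hψ : ψ ∈ IsManifold.maximalAtlas (𝓡 k) ∞ X := h.codChart_mem_maximalAtlas
  have hx₀φ : x₀ ∈ φ.source := h.mem_domChart_source
  have hfx₀ψ : f x₀ ∈ ψ.source := h.mem_codChart_source
  have hsrc : φ.source ⊆ f ⁻¹' ψ.source := h.source_subset_preimage_source
  have hwr : EqOn ((ψ.extend (𝓡 k)) ∘ f ∘ (φ.extend (𝓡∂ m)).symm) (L ∘ (·, 0))
      (φ.extend (𝓡∂ m)).target := h.writtenInCharts
  -- the transition `T = Ξ ∘ ψ⁻¹`
  set T : PartialEquiv (EuclideanSpace ℝ (Fin k)) (EuclideanSpace ℝ (Fin k)) :=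
    (𝓡 k).extendCoordChange ψ Ξ with hT_def
  have hTsrc : T.source = (ψ.extend (𝓡 k)).target ∩ (ψ.extend (𝓡 k)).symm ⁻¹' Ξ.source := by
    rw [hT_def, ModelWithCorners.extendCoordChange, PartialEquiv.trans_source,
      PartialEquiv.symm_source, OpenPartialHomeomorph.extend_source]
  have hTopen : IsOpen T.source := by
    rw [hTsrc]
    exact (ψ.continuousOn_extend_symm (I := 𝓡 k)).isOpen_inter_preimage
      (ψ.isOpen_extend_target (I := 𝓡 k)) Ξ.open_source
  have hTsmooth : ContDiffOn ℝ ∞ T T.source :=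
    (𝓡 k).contDiffOn_extendCoordChange hψ hΞ
  have hTapply : ∀ w, T w = Ξ ((ψ.extend (𝓡 k)).symm w) := by
    intro w
    simp [hT_def, ModelWithCorners.extendCoordChange]
  -- the inclusion `u ↦ L (u, 0)`
  set A : EuclideanSpace ℝ (Fin m) → EuclideanSpace ℝ (Fin k) := fun u => L (u, 0) with hA_def
  have hAlin : A = fun u =>
      ((L : (EuclideanSpace ℝ (Fin m) × h.complement) →L[ℝ] EuclideanSpace ℝ (Fin k)).comp
        (ContinuousLinearMap.inl ℝ (EuclideanSpace ℝ (Fin m)) h.complement)) u := by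
    funext u
    simp [hA_def]
  have hAc : Continuous A := L.continuous.comp (continuous_id.prodMk continuous_const)
  have hAsmooth : ContDiff ℝ ∞ A := by
    rw [hAlin]
    exact ContinuousLinearMap.contDiff _
  -- the domains
  set Ω₁ : Set (EuclideanSpace ℝ (Fin m)) := A ⁻¹' T.source with hΩ₁_def
  set Ω₀ : Set (EuclideanSpace ℝ (Fin m)) := (𝓡∂ m).symm ⁻¹' φ.target with hΩ₀_def
  have hΩ₁o : IsOpen Ω₁ := hTopen.preimage hAc
  have hΩ₀o : IsOpen Ω₀ := φ.open_target.preimage (𝓡∂ m).continuous_symm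
  have htarget : (φ.extend (𝓡∂ m)).target = Ω₀ ∩ {u | 0 ≤ u 0} := by
    rw [OpenPartialHomeomorph.extend_target, range_modelWithCornersEuclideanHalfSpace]
  set Ω : Set (EuclideanSpace ℝ (Fin m)) := Ω₁ ∩ Ω₀ with hΩ_def
  have hΩo : IsOpen Ω := hΩ₁o.inter hΩ₀o
  set u₀ : EuclideanSpace ℝ (Fin m) := φ.extend (𝓡∂ m) x₀ with hu₀_def
  have hu₀t : u₀ ∈ (φ.extend (𝓡∂ m)).target :=
    (φ.extend (𝓡∂ m)).map_source (by rwa [OpenPartialHomeomorph.extend_source])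
  have hu₀x₀ : (φ.extend (𝓡∂ m)).symm u₀ = x₀ :=
    (φ.extend (𝓡∂ m)).left_inv (by rwa [OpenPartialHomeomorph.extend_source])
  -- on the half target, `A u = ψ (f (φ⁻¹ u))`
  have hAeq : ∀ u ∈ (φ.extend (𝓡∂ m)).target,
      A u = ψ.extend (𝓡 k) (f ((φ.extend (𝓡∂ m)).symm u)) := fun u hu => (hwr hu).symm
  have hmemT : ∀ u ∈ (φ.extend (𝓡∂ m)).target,
      f ((φ.extend (𝓡∂ m)).symm u) ∈ Ξ.source → A u ∈ T.source := by
    intro u hu hΞu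
    have hxs : (φ.extend (𝓡∂ m)).symm u ∈ φ.source := by
      have := (φ.extend (𝓡∂ m)).map_target hu
      rwa [OpenPartialHomeomorph.extend_source] at this
    have hfψ : f ((φ.extend (𝓡∂ m)).symm u) ∈ ψ.source := hsrc hxs
    rw [hTsrc, hAeq u hu]
    refine ⟨(ψ.extend (𝓡 k)).map_source (by rwa [OpenPartialHomeomorph.extend_source]), ?_⟩
    show (ψ.extend (𝓡 k)).symm (ψ.extend (𝓡 k) (f ((φ.extend (𝓡∂ m)).symm u))) ∈ Ξ.source
    rwa [(ψ.extend (𝓡 k)).left_inv (by rwa [OpenPartialHomeomorph.extend_source])]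
  have hu₀Ω : u₀ ∈ Ω := by
    refine ⟨?_, (htarget ▸ hu₀t).1⟩
    show A u₀ ∈ T.source
    exact hmemT u₀ hu₀t (by rwa [hu₀x₀])
  -- the maps
  set G : EuclideanSpace ℝ (Fin m) → X := fun u => (ψ.extend (𝓡 k)).symm (A u) with hG_def
  set E : EuclideanSpace ℝ (Fin m) → EuclideanSpace ℝ (Fin k) := fun u => T (A u) with hE_def
  have hGΞ : ∀ u ∈ Ω, G u ∈ Ξ.source ∧ E u = Ξ (G u) := by
    intro u hu
    have h1 : A u ∈ T.source := hu.1
    rw [hTsrc] at h1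
    exact ⟨h1.2, hTapply (A u)⟩
  have hGc : ContinuousOn G Ω := by
    refine (ψ.continuousOn_extend_symm (I := 𝓡 k)).comp hAc.continuousOn fun u hu => ?_
    have h1 : A u ∈ T.source := hu.1
    rw [hTsrc] at h1
    exact h1.1
  have hEsmooth : ContDiffOn ℝ ∞ E Ω :=
    hTsmooth.comp hAsmooth.contDiffOn fun u hu => hu.1
  -- `G = f ∘ φ⁻¹` on the half
  have hhalf : ∀ u ∈ Ω, 0 ≤ u 0 → u ∈ (φ.extend (𝓡∂ m)).target := fun u hu hu0 =>
    htarget ▸ ⟨hu.2, hu0⟩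
  have hsymm_src : ∀ u ∈ (φ.extend (𝓡∂ m)).target, (φ.extend (𝓡∂ m)).symm u ∈ φ.source := by
    intro u hu
    have := (φ.extend (𝓡∂ m)).map_target hu
    rwa [OpenPartialHomeomorph.extend_source] at this
  have hGf : ∀ u ∈ (φ.extend (𝓡∂ m)).target, G u = f ((φ.extend (𝓡∂ m)).symm u) := by
    intro u hu
    show (ψ.extend (𝓡 k)).symm (A u) = _
    rw [hAeq u hu]
    exact (ψ.extend (𝓡 k)).left_inv
      (by rw [OpenPartialHomeomorph.extend_source]; exact hsrc (hsymm_src u hu))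
  -- boundary points
  have hbdry : ∀ x ∈ φ.source, ((𝓡∂ m).IsBoundaryPoint x ↔ (φ.extend (𝓡∂ m) x) 0 = 0) := by
    intro x hx
    rw [isBoundaryPoint_iff_of_mem_maximalAtlas (by simp) hφ hx,
      frontier_range_modelWithCornersEuclideanHalfSpace]
    exact ⟨fun h => (h : (0 : ℝ) = _).symm, fun h => (h.symm : (0 : ℝ) = _)⟩
  -- conclusion
  refine ⟨E, G, u₀, Ω, hΩo, hu₀Ω, hEsmooth, ?_, (htarget ▸ hu₀t).2, ?_, ?_, hGc, hGΞ, ?_, ?_, ?_⟩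
  · -- injectivity of the differential
    have hw₀ : A u₀ ∈ T.source := hu₀Ω.1
    have hTd : HasFDerivAt T (fderiv ℝ T (A u₀)) (A u₀) :=
      ((hTsmooth.differentiableOn (by simp)).differentiableAt (hTopen.mem_nhds hw₀)).hasFDerivAt
    have hAd : HasFDerivAt A
        ((L : (EuclideanSpace ℝ (Fin m) × h.complement) →L[ℝ] EuclideanSpace ℝ (Fin k)).comp
          (ContinuousLinearMap.inl ℝ (EuclideanSpace ℝ (Fin m)) h.complement)) u₀ := by
      rw [hAlin]
      exact (ContinuousLinearMap.hasFDerivAt _)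
    have hEd : HasFDerivAt E ((fderiv ℝ T (A u₀)).comp
        ((L : (EuclideanSpace ℝ (Fin m) × h.complement) →L[ℝ] EuclideanSpace ℝ (Fin k)).comp
          (ContinuousLinearMap.inl ℝ (EuclideanSpace ℝ (Fin m)) h.complement))) u₀ :=
      hTd.comp u₀ hAd
    rw [hEd.fderiv]
    have hinv : (fderiv ℝ T (A u₀)).IsInvertible := by
      have := (𝓡 k).isInvertible_fderivWithin_extendCoordChange (n := ∞) (by simp) hψ hΞ hw₀
      rwa [fderivWithin_of_isOpen hTopen hw₀] at this
    have h1 : Injective (fderiv ℝ T (A u₀)) := hinv.injective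
    have h2 : Injective (ContinuousLinearMap.inl ℝ (EuclideanSpace ℝ (Fin m)) h.complement) :=
      fun a b hab => (Prod.ext_iff.1 hab).1
    exact h1.comp (L.injective.comp h2)
  · -- boundary point iff `u₀ 0 = 0`
    exact hbdry x₀ hx₀φ
  · -- `G u₀ = f x₀`
    rw [hGf u₀ hu₀t, hu₀x₀]
  · -- local images: `f` is an embedding
    intro Ω' hΩ'Ω hΩ'o hu₀Ω'
    set Aset : Set M := φ.source ∩ φ.extend (𝓡∂ m) ⁻¹' Ω' with hAset_def
    have hAset : IsOpen Aset := φ.isOpen_extend_preimage (I := 𝓡∂ m) hΩ'o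
    obtain ⟨t, ht, hft⟩ := hf.isEmbedding.isInducing.isOpen_iff.1 hAset
    refine ⟨t ∩ Ξ.source, ht.inter Ξ.open_source, ?_, inter_subset_right, ?_⟩
    · have : x₀ ∈ Aset := ⟨hx₀φ, hu₀Ω'⟩
      rw [← hft] at this
      exact ⟨this, hx₀⟩
    · apply Subset.antisymm
      · rintro y ⟨⟨x, rfl⟩, hyt, -⟩
        have hxA : x ∈ Aset := by rw [← hft]; exact hyt
        have hxt : φ.extend (𝓡∂ m) x ∈ (φ.extend (𝓡∂ m)).target :=
          (φ.extend (𝓡∂ m)).map_source (by rw [OpenPartialHomeomorph.extend_source]; exact hxA.1)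
        refine ⟨φ.extend (𝓡∂ m) x, ⟨hxA.2, (htarget ▸ hxt).2⟩, ?_⟩
        rw [hGf _ hxt, (φ.extend (𝓡∂ m)).left_inv
          (by rw [OpenPartialHomeomorph.extend_source]; exact hxA.1)]
      · rintro y ⟨u, ⟨huΩ', hu0⟩, rfl⟩
        have huΩ : u ∈ Ω := hΩ'Ω huΩ'
        have hut := hhalf u huΩ hu0
        have hxs := hsymm_src u hut
        have hxA : (φ.extend (𝓡∂ m)).symm u ∈ Aset := by
          refine ⟨hxs, ?_⟩
          show φ.extend (𝓡∂ m) ((φ.extend (𝓡∂ m)).symm u) ∈ Ω'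
          rwa [(φ.extend (𝓡∂ m)).right_inv hut]
        rw [← hft] at hxA
        refine ⟨?_, ?_, (hGΞ u huΩ).1⟩
        · rw [hGf u hut]; exact mem_range_self _
        · rw [hGf u hut]; exact hxA
  · -- injectivity on the half
    intro u hu u' hu' heq
    have hut := hhalf u hu.1 hu.2
    have hut' := hhalf u' hu'.1 hu'.2
    rw [hGf u hut, hGf u' hut'] at heq
    have := hf.isEmbedding.injective heq
    exact (φ.extend (𝓡∂ m)).symm.injOn hut hut' this
  · -- boundary points of the half
    intro u hu hu0
    have hut := hhalf u hu hu0
    refine ⟨(φ.extend (𝓡∂ m)).symm u, hGf u hut, ?_⟩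
    rw [hbdry _ (hsymm_src u hut), (φ.extend (𝓡∂ m)).right_inv hut]

end Literature.Topology.FourManifolds
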